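import Mathlib
import Literature.Combinatorics.Additive.ArithmeticRemovalProofs

/-! # `DivisionGap.PerMultiplesHard` (stmt-ValiantsHypothesis-5068), line `uncharged-face-walk`:
stub `denseRegularPair` — one dense `ε`-regular balanced pair from Szemerédi's lemma (lead c9, cycle 9)

For `D, P, Cc ≥ 1` there are `M, N₀` (depending on `D, P, Cc` only) such that every bipartite
graph `X ⊆ Fin N × Fin N` (rows `e.1`, columns `e.2`), `N ≥ N₀`, `N² ≤ D · #X`, contains rows `V`
and columns `W` of a common size `m`, `N ≤ M m`, `Cc m ≤ N`, with `m² ≤ 256 D · e_X(V, W)` and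
`|e_X(S,T)/(#S #T) - e_X(V,W)/m²| ≤ 1/P` for all `S ⊆ V`, `T ⊆ W` with `m ≤ P #S`, `m ≤ P #T`
(`stub_denseRegularPair`).  Route: the bipartite graph `Γ` of `X` on `Fin N ⊕ Fin N`
(`inl x ∼ inr y ↔ (x, y) ∈ X`) has `≥ #X ≥ N²/D > (4 ε₀ + ε₁/2 + 4 η) (2N)²` ordered edges
(`ε₀ = 1/(1024 D P)`, `ε₁ = 1/(16 D)`, `η = 1/(64 D)`; `constants_bounds`, `edges_lower_bound`);
Mathlib's `szemeredi_regularity` (`l = 64 D + 2 Cc ≥ 4/ε₁` initial parts) and the count of the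
ordered edges lost in the reduced graph (the tree's `KralSerraVena.card_unreduced_le`) give an
`ε₀`-uniform pair of parts of density `≥ η` and sizes `a` or `a + 1`, `a = 2N/k`,
`l ≤ k ≤ L = bound ε₀ l` (`exists_uniform_dense_pair`); one orientation has `≥ #U₁/(128 D)` rows
in `U₁` and `≥ #U₂/(128 D)` columns in `U₂` (`exists_orientation`); with `m = a/(256 D) + 1`
(`nat_sizes`: `128 D m ≤ a < 256 D m`, `N ≤ 256 D L m`, `Cc m ≤ N`) any `m` rows and `m` columns
of those work, both `(V, W)` and `(S, T)` being large enough for the `ε₀`-uniformity, since the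
edge density of `Γ` between lifted rows and columns is the `X`-edge count (`edgeDensity_map`,
`restrict_pair`).  So `M = 256 D L`, `N₀ = 128 D L` (tower-type in `D P`).
[folklore] (Szemerédi 1978; Komlós–Simonovits, *Szemerédi's regularity lemma and its
applications in graph theory*, 1996, §1.) -/

-- `Summit.ValiantsHypothesis.ValiantsHypothesis.…` is the tree's mandated layout (Sub = Summit).
set_option linter.dupNamespace false

open Finset SzemerediRegularity
open scoped BigOperators

namespace Summit.ValiantsHypothesis.ValiantsHypothesis.Theorems.DivisionGap.PerMultiplesHard.DenseRegularPair

/-- **A dense uniform pair of parts.** A graph on `W` with more than `(4 ε₀ + ε₁/2 + 4 η) |W|²`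
ordered edges, `4/ε₁ ≤ l ≤ |W|`, has in Szemerédi's equipartition (`k` parts, `l ≤ k ≤ bound ε₀ l`,
part sizes `|W|/k` or `|W|/k + 1`) an `ε₀`-uniform pair of parts of edge density `≥ η`. [folklore] -/
theorem exists_uniform_dense_pair {W : Type*} [Fintype W] [DecidableEq W] [Nonempty W]
    (G : SimpleGraph W) [DecidableRel G.Adj] {ε₀ η ε₁ : ℝ} (hε₀ : 0 < ε₀) (hη : 0 ≤ η)
    (hε₁ : 0 < ε₁) {l : ℕ} (hl : l ≤ Fintype.card W) (hlε : 4 / ε₁ ≤ l)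
    (hE : (4 * ε₀ + ε₁ / 2 + 4 * η) * (Fintype.card W) ^ 2 <
      #(univ.filter fun e : W × W => G.Adj e.1 e.2)) :
    ∃ (k : ℕ) (U U' : Finset W), l ≤ k ∧ k ≤ bound ε₀ l ∧
      Fintype.card W / k ≤ #U ∧ #U ≤ Fintype.card W / k + 1 ∧
      Fintype.card W / k ≤ #U' ∧ #U' ≤ Fintype.card W / k + 1 ∧
      G.IsUniform ε₀ U U' ∧ η ≤ G.edgeDensity U U' := by
  obtain ⟨Q, hQeq, hlQ, hQb, hQU⟩ := szemeredi_regularity G hε₀ hl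
  have hparts : 4 / ε₁ ≤ #Q.parts := hlε.trans (by exact_mod_cast hlQ)
  have hlost := Literature.Combinatorics.Additive.KralSerraVena.card_unreduced_le G hQeq hQU hε₀
    hη hε₁ hparts
  obtain ⟨e, he, hne⟩ := exists_mem_notMem_of_card_lt_card (s := univ.filter fun e : W × W =>
    G.Adj e.1 e.2 ∧ ¬ (G.regularityReduced Q ε₀ η).Adj e.1 e.2)
    (t := univ.filter fun e : W × W => G.Adj e.1 e.2) (by exact_mod_cast hlost.trans_lt hE)
  simp only [mem_filter, mem_univ, true_and, not_and, not_not] at he hne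
  obtain ⟨-, U, hU, U', hU', -, -, -, huni, hdens⟩ := hne he
  have ha := Finset.card_univ (α := W)
  exact ⟨#Q.parts, U, U', hlQ, hQb, ha ▸ hQeq.average_le_card_part hU,
    ha ▸ hQeq.card_part_le_average_add_one hU, ha ▸ hQeq.average_le_card_part hU',
    ha ▸ hQeq.card_part_le_average_add_one hU', huni, hdens⟩

/-- **Edge density between lifted rows and lifted columns.** In the bipartite graph `G` of `X` on
`Fin N ⊕ Fin N` (`inl x ∼ inr y ↔ (x, y) ∈ X`, no other edges) the edges between `inl '' S` and
`inr '' T` are the pairs of `X` in `S × T`, so `d_G(inl '' S, inr '' T) = e_X(S, T)/(#S #T)`.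
[folklore] -/
theorem edgeDensity_map {N : ℕ} (X : Finset (Fin N × Fin N))
    (G : SimpleGraph (Fin N ⊕ Fin N)) [DecidableRel G.Adj]
    (hG : ∀ a b, G.Adj a b ↔ ∃ x y, (x, y) ∈ X ∧
      (a = Sum.inl x ∧ b = Sum.inr y ∨ a = Sum.inr y ∧ b = Sum.inl x))
    (S T : Finset (Fin N)) :
    (G.edgeDensity (S.map .inl) (T.map .inr) : ℝ) =
      (((X.filter fun e => e.1 ∈ S ∧ e.2 ∈ T).card : ℕ) : ℝ) / ((S.card : ℝ) * (T.card : ℝ)) := by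
  have key : G.interedges (S.map .inl) (T.map .inr) = (X.filter fun e => e.1 ∈ S ∧ e.2 ∈ T).map
      (Function.Embedding.inl.prodMap Function.Embedding.inr) := by
    ext ⟨a, b⟩
    simp only [SimpleGraph.mk_mem_interedges_iff, mem_map, Function.Embedding.inl_apply,
      Function.Embedding.inr_apply, mem_filter, Function.Embedding.coe_prodMap, Prod.map_apply,
      Prod.mk.injEq, hG, Prod.exists]
    constructor
    · rintro ⟨⟨x, hx, rfl⟩, ⟨y, hy, rfl⟩, x', y', hxy, ⟨h1, h2⟩ | ⟨h1, _⟩⟩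
      · cases h1
        cases h2
        exact ⟨x, y, ⟨hxy, hx, hy⟩, rfl, rfl⟩
      · cases h1
    · rintro ⟨x, y, ⟨hxy, hx, hy⟩, rfl, rfl⟩
      exact ⟨⟨x, hx, rfl⟩, ⟨y, hy, rfl⟩, x, y, hxy, Or.inl ⟨rfl, rfl⟩⟩
  rw [SimpleGraph.edgeDensity_def, key, card_map, card_map, card_map]
  push_cast
  rfl

/-- **One orientation**: from `η/2 · #U #U' ≤ #rows(U) · #cols(U')` (and `#U, #U' > 0`) to
`#rows(U) ≥ η #U / 2` and `#cols(U') ≥ η #U' / 2`. [folklore] -/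
theorem orient_half {N : ℕ} {η : ℝ} {U U' : Finset (Fin N ⊕ Fin N)} (hU : (0 : ℝ) < #U)
    (hU' : (0 : ℝ) < #U') (h : η / 2 * #U * #U' ≤ #U.toLeft * #U'.toRight) :
    η / 2 * #U ≤ #U.toLeft ∧ η / 2 * #U' ≤ #U'.toRight := by
  have hL : (#U.toLeft : ℝ) ≤ #U := by exact_mod_cast card_toLeft_le
  have hR' : (#U'.toRight : ℝ) ≤ #U' := by exact_mod_cast card_toRight_le
  refine ⟨le_of_mul_le_mul_right (h.trans (by gcongr)) hU', le_of_mul_le_mul_right ?_ hU⟩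
  calc η / 2 * #U' * #U = η / 2 * #U * #U' := by ring
    _ ≤ #U.toLeft * #U'.toRight := h
    _ ≤ #U * #U'.toRight := by gcongr
    _ = #U'.toRight * #U := by ring

/-- **Orientation of a dense pair.** In the bipartite graph of `X`, a pair `(U, U')` of nonempty
sets of edge density `≥ η` satisfies `e(U, U') ≤ #rows(U) #cols(U') + #cols(U) #rows(U')`, so for
one orientation `(U₁, U₂) ∈ {(U, U'), (U', U)}` the rows `R` of `U₁` and the columns `C` of `U₂`
have `#R ≥ η #U₁ / 2`, `#C ≥ η #U₂ / 2`. [folklore] -/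
theorem exists_orientation {N : ℕ} (X : Finset (Fin N × Fin N))
    (G : SimpleGraph (Fin N ⊕ Fin N)) [DecidableRel G.Adj]
    (hG : ∀ a b, G.Adj a b ↔ ∃ x y, (x, y) ∈ X ∧
      (a = Sum.inl x ∧ b = Sum.inr y ∨ a = Sum.inr y ∧ b = Sum.inl x))
    {η : ℝ} {U U' : Finset (Fin N ⊕ Fin N)} (hU : 0 < #U) (hU' : 0 < #U')
    (hd : η ≤ G.edgeDensity U U') :
    ∃ (U₁ U₂ : Finset (Fin N ⊕ Fin N)) (R C : Finset (Fin N)),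
      (U₁ = U ∧ U₂ = U' ∨ U₁ = U' ∧ U₂ = U) ∧ R.map .inl ⊆ U₁ ∧ C.map .inr ⊆ U₂ ∧
      η / 2 * #U₁ ≤ #R ∧ η / 2 * #U₂ ≤ #C := by
  have hUpos : (0 : ℝ) < #U := by exact_mod_cast hU
  have hU'pos : (0 : ℝ) < #U' := by exact_mod_cast hU'
  have hd' : η * (#U * #U') ≤ #(G.interedges U U') := by
    rw [SimpleGraph.edgeDensity_def] at hd
    push_cast at hd
    rwa [le_div_iff₀ (by positivity)] at hd
  have hsub : G.interedges U U' ⊆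
      (U.toLeft ×ˢ U'.toRight).map (Function.Embedding.inl.prodMap Function.Embedding.inr) ∪
        (U.toRight ×ˢ U'.toLeft).map (Function.Embedding.inr.prodMap Function.Embedding.inl) := by
    rintro ⟨a, b⟩ h
    rw [SimpleGraph.mk_mem_interedges_iff, hG] at h
    obtain ⟨ha, hb, x, y, -, ⟨rfl, rfl⟩ | ⟨rfl, rfl⟩⟩ := h
    · exact mem_union_left _ (mem_map.2 ⟨(x, y),
        mem_product.2 ⟨mem_toLeft.2 ha, mem_toRight.2 hb⟩, rfl⟩)
    · exact mem_union_right _ (mem_map.2 ⟨(y, x),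
        mem_product.2 ⟨mem_toRight.2 ha, mem_toLeft.2 hb⟩, rfl⟩)
  have hcard : (#(G.interedges U U') : ℝ) ≤
      #U.toLeft * #U'.toRight + #U.toRight * #U'.toLeft := by
    have := (card_le_card hsub).trans (card_union_le _ _)
    rw [card_map, card_map, card_product, card_product] at this
    exact_mod_cast this
  by_cases h1 : η / 2 * #U * #U' ≤ #U.toLeft * #U'.toRight
  · obtain ⟨h2, h3⟩ := orient_half hUpos hU'pos h1
    exact ⟨U, U', U.toLeft, U'.toRight, Or.inl ⟨rfl, rfl⟩,
      map_inl_subset_iff_subset_toLeft.2 Subset.rfl,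
      map_inr_subset_iff_subset_toRight.2 Subset.rfl, h2, h3⟩
  · have h2 : η / 2 * #U' * #U ≤ #U'.toLeft * #U.toRight := by
      have h3 := not_le.1 h1
      nlinarith [h3, hcard, hd']
    obtain ⟨h3, h4⟩ := orient_half hU'pos hUpos h2
    exact ⟨U', U, U'.toLeft, U.toRight, Or.inr ⟨rfl, rfl⟩,
      map_inl_subset_iff_subset_toLeft.2 Subset.rfl,
      map_inr_subset_iff_subset_toRight.2 Subset.rfl, h3, h4⟩

/-- **Restriction of a dense uniform pair to a balanced sub-pair.** In the bipartite graph of `X`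
let `(U₁, U₂)` be `ε₀`-uniform of density `≥ η`, `R` rows in `U₁`, `C` columns in `U₂`,
`m ≤ #R, #C`, `ε₀ P #Uᵢ ≤ m`, `2 ε₀ ≤ 1/P`, `1/(256 D) ≤ η - ε₀`. Then `m`-subsets `V ⊆ R`,
`W ⊆ C` have `m² ≤ 256 D e_X(V, W)` and `|e_X(S,T)/(#S #T) - e_X(V,W)/m²| ≤ 1/P` for `S ⊆ V`,
`T ⊆ W`, `m ≤ P #S`, `m ≤ P #T` (both pairs are large enough for the uniformity). [folklore] -/
theorem restrict_pair {N : ℕ} (X : Finset (Fin N × Fin N))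
    (G : SimpleGraph (Fin N ⊕ Fin N)) [DecidableRel G.Adj]
    (hG : ∀ a b, G.Adj a b ↔ ∃ x y, (x, y) ∈ X ∧
      (a = Sum.inl x ∧ b = Sum.inr y ∨ a = Sum.inr y ∧ b = Sum.inl x))
    {ε₀ η : ℝ} {D P m : ℕ} (hP : 1 ≤ P) (hD : 1 ≤ D)
    {U₁ U₂ : Finset (Fin N ⊕ Fin N)} (hu : G.IsUniform ε₀ U₁ U₂)
    (hd : η ≤ G.edgeDensity U₁ U₂) {R C : Finset (Fin N)} (hR : R.map .inl ⊆ U₁)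
    (hC : C.map .inr ⊆ U₂) (hmR : m ≤ #R) (hmC : m ≤ #C) (hm₁ : ε₀ * #U₁ * P ≤ m)
    (hm₂ : ε₀ * #U₂ * P ≤ m) (hεP : 2 * ε₀ ≤ 1 / P) (hDη : 1 / (256 * D) ≤ η - ε₀) :
    ∃ V W : Finset (Fin N), V.card = m ∧ W.card = m ∧
      m * m ≤ 256 * D * (X.filter fun e => e.1 ∈ V ∧ e.2 ∈ W).card ∧
      ∀ S ⊆ V, ∀ T ⊆ W, m ≤ P * S.card → m ≤ P * T.card →
        |(((X.filter fun e => e.1 ∈ S ∧ e.2 ∈ T).card : ℕ) : ℝ) / ((S.card : ℝ) * (T.card : ℝ)) -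
          (((X.filter fun e => e.1 ∈ V ∧ e.2 ∈ W).card : ℕ) : ℝ) / ((m : ℝ) * (m : ℝ))|
          ≤ 1 / (P : ℝ) := by
  obtain ⟨V, hVR, hVm⟩ := exists_subset_card_eq hmR
  obtain ⟨W, hWC, hWm⟩ := exists_subset_card_eq hmC
  have hP0 : (0 : ℝ) < P := by exact_mod_cast hP
  have hP1 : (1 : ℝ) ≤ P := by exact_mod_cast hP
  have hD0 : (0 : ℝ) < D := by exact_mod_cast hD
  have hV : V.map Function.Embedding.inl ⊆ U₁ := (map_subset_map.2 hVR).trans hR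
  have hW : W.map Function.Embedding.inr ⊆ U₂ := (map_subset_map.2 hWC).trans hC
  have key : ∀ S ⊆ V, ∀ T ⊆ W, (m : ℝ) ≤ P * #S → (m : ℝ) ≤ P * #T →
      |(((X.filter fun e => e.1 ∈ S ∧ e.2 ∈ T).card : ℕ) : ℝ) / ((S.card : ℝ) * (T.card : ℝ)) -
        G.edgeDensity U₁ U₂| < ε₀ := by
    intro S hS T hT hmS hmT
    have h := hu ((map_subset_map.2 hS).trans hV) ((map_subset_map.2 hT).trans hW) ?_ ?_
    · rwa [edgeDensity_map X G hG] at h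
    · rw [card_map]
      have h1 : ε₀ * #U₁ * P ≤ #S * P := by linarith
      linarith [le_of_mul_le_mul_right h1 hP0]
    · rw [card_map]
      have h1 : ε₀ * #U₂ * P ≤ #T * P := by linarith
      linarith [le_of_mul_le_mul_right h1 hP0]
  have hmm : (m : ℝ) ≤ P * m := le_mul_of_one_le_left (Nat.cast_nonneg _) hP1
  have kV := key V Subset.rfl W Subset.rfl (by rw [hVm]; exact hmm) (by rw [hWm]; exact hmm)
  rw [hVm, hWm] at kV
  refine ⟨V, W, hVm, hWm, ?_, fun S hS T hT hmS hmT => ?_⟩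
  · rw [abs_sub_lt_iff] at kV
    have h1 : 1 / (256 * (D : ℝ)) < (((X.filter fun e => e.1 ∈ V ∧ e.2 ∈ W).card : ℕ) : ℝ) /
        ((m : ℝ) * (m : ℝ)) := by linarith [kV.2]
    rcases Nat.eq_zero_or_pos m with hm0 | hm0
    · simp [hm0]
    · have hmpos : (0 : ℝ) < (m : ℝ) * (m : ℝ) := by positivity
      rw [div_lt_div_iff₀ (by positivity) hmpos, one_mul] at h1
      have h2 : ((m * m : ℕ) : ℝ) ≤
          ((256 * D * (X.filter fun e => e.1 ∈ V ∧ e.2 ∈ W).card : ℕ) : ℝ) := by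
        push_cast
        linarith
      exact_mod_cast h2
  · have kS := key S hS T hT (by exact_mod_cast hmS) (by exact_mod_cast hmT)
    refine le_trans (le_of_lt ?_) hεP
    calc _ = |((((X.filter fun e => e.1 ∈ S ∧ e.2 ∈ T).card : ℕ) : ℝ) /
              ((S.card : ℝ) * (T.card : ℝ)) - G.edgeDensity U₁ U₂) -
            ((((X.filter fun e => e.1 ∈ V ∧ e.2 ∈ W).card : ℕ) : ℝ) / ((m : ℝ) * (m : ℝ)) -
              G.edgeDensity U₁ U₂)| := by ring_nf
      _ ≤ _ := abs_sub _ _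
      _ < ε₀ + ε₀ := add_lt_add kS kV
      _ = 2 * ε₀ := by ring

/-- **The constants.** With `ε₀ = 1/(1024 D P)`, `η = 1/(64 D)`, `ε₁ = 1/(16 D)`:
`2 ε₀ ≤ 1/P`, `1/(256 D) ≤ η - ε₀`, `4 ε₀ + ε₁/2 + 4 η ≤ 25/(256 D)` and `4/ε₁ = 64 D`.
[folklore] -/
theorem constants_bounds {D P : ℕ} (hD : 1 ≤ D) (hP : 1 ≤ P) :
    2 * (1 / (1024 * (D : ℝ) * P)) ≤ 1 / P ∧
    1 / (256 * (D : ℝ)) ≤ 1 / (64 * D) - 1 / (1024 * D * P) ∧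
    4 * (1 / (1024 * (D : ℝ) * P)) + 1 / (16 * D) / 2 + 4 * (1 / (64 * D)) ≤ 25 / (256 * D) ∧
    (4 : ℝ) / (1 / (16 * D)) = 64 * D := by
  have hD0 : (0 : ℝ) < D := by exact_mod_cast hD
  have hD1 : (1 : ℝ) ≤ D := by exact_mod_cast hD
  have hP0 : (0 : ℝ) < P := by exact_mod_cast hP
  have hP1 : (1 : ℝ) ≤ P := by exact_mod_cast hP
  have hε₀le : 1 / (1024 * (D : ℝ) * P) ≤ 1 / (1024 * D) :=
    one_div_le_one_div_of_le (by positivity) (le_mul_of_one_le_right (by positivity) hP1)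
  have h4 : (0 : ℝ) < 1 / (1024 * D) := by positivity
  refine ⟨?_, ?_, ?_, ?_⟩
  · rw [mul_one_div, div_le_div_iff₀ (by positivity) hP0, one_mul]
    nlinarith
  · have h2 : (1 : ℝ) / (256 * D) = 4 * (1 / (1024 * D)) := by field_simp; ring
    have h3 : (1 : ℝ) / (64 * D) = 16 * (1 / (1024 * D)) := by field_simp; ring
    linarith
  · have h2 : 4 * (1 / (1024 * (D : ℝ))) + 1 / (16 * D) / 2 + 4 * (1 / (64 * D)) =
        25 / (256 * D) := by field_simp; ring
    linarith
  · rw [div_div_eq_mul_div, div_one]; ring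

/-- **Size bookkeeping in `ℕ`.** With `a = 2N/k`, `m = a/(256 D) + 1`, `64 D + 2 Cc ≤ k ≤ L` and
`128 D L ≤ N`: `256 D ≤ a`, `128 D m ≤ a < 256 D m`, `N ≤ 256 D L m` and `Cc m ≤ N`.
[folklore] -/
theorem nat_sizes {D Cc N k L l : ℕ} (hD : 1 ≤ D) (hCc : 1 ≤ Cc) (hl : l = 64 * D + 2 * Cc)
    (hlk : l ≤ k) (hkL : k ≤ L) (hN : 128 * D * L ≤ N) :
    256 * D ≤ 2 * N / k ∧ 128 * D * (2 * N / k / (256 * D) + 1) ≤ 2 * N / k ∧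
    2 * N / k < 256 * D * (2 * N / k / (256 * D) + 1) ∧
    N ≤ 256 * D * L * (2 * N / k / (256 * D) + 1) ∧ Cc * (2 * N / k / (256 * D) + 1) ≤ N := by
  set a := 2 * N / k
  set m := a / (256 * D) + 1
  have hkpos : 0 < k := by omega
  have hLpos : 0 < L := by omega
  have h256 : 256 * D ≤ a := by
    refine le_trans ?_ (Nat.div_le_div_left hkL hkpos)
    rw [Nat.le_div_iff_mul_le hLpos]
    calc 256 * D * L = 2 * (128 * D * L) := by ring
      _ ≤ 2 * N := Nat.mul_le_mul_left 2 hN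
  have hlt : a < 256 * D * m := Nat.lt_mul_div_succ a (by omega)
  have h128 : 128 * D * m ≤ a := by
    have h1 : 256 * D * (a / (256 * D)) ≤ a := Nat.mul_div_le a (256 * D)
    have h2 : 128 * D * m = 128 * (D * (a / (256 * D))) + 128 * D := by ring
    have h3 : 256 * D * (a / (256 * D)) = 256 * (D * (a / (256 * D))) := by ring
    omega
  refine ⟨h256, h128, hlt, ?_, ?_⟩
  · calc N ≤ 2 * N := by omega
      _ ≤ k * (a + 1) := (Nat.lt_mul_div_succ _ hkpos).le
      _ ≤ L * (256 * D * m) := Nat.mul_le_mul hkL hlt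
      _ = 256 * D * L * m := by ring
  · have h1 : m ≤ a := le_trans (Nat.le_mul_of_pos_left m (by omega)) h128
    have h2 : a ≤ 2 * N / (2 * Cc) := Nat.div_le_div_left (by omega) (by omega)
    rw [Nat.mul_div_mul_left N Cc (by norm_num)] at h2
    calc Cc * m ≤ Cc * (N / Cc) := Nat.mul_le_mul_left Cc (h1.trans h2)
      _ ≤ N := Nat.mul_div_le N Cc

/-- **From `128 D m ≤ a ≤ u` and `u/(128 D) ≤ r` to `m ≤ r`** (`u` a part size, `r` its number
of rows or columns). [folklore] -/
theorem cast_le_of_rows {D m a : ℕ} (hD : 1 ≤ D) (h128 : 128 * D * m ≤ a) {u r : ℝ}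
    (hu : (a : ℝ) ≤ u) (hr : 1 / (64 * (D : ℝ)) / 2 * u ≤ r) : (m : ℝ) ≤ r := by
  have hD0 : (0 : ℝ) < D := by exact_mod_cast hD
  have h1 : (128 : ℝ) * D * m ≤ a := by exact_mod_cast h128
  have h2 : 1 / (64 * (D : ℝ)) / 2 * u = u / (128 * D) := by field_simp; ring
  rw [h2, div_le_iff₀ (by positivity)] at hr
  have h3 : (128 * D : ℝ) * m ≤ (128 * D) * r := by linarith
  exact le_of_mul_le_mul_left h3 (by positivity)

/-- **From `u ≤ a + 1 ≤ 256 D m` to `ε₀ u P ≤ m`** with `ε₀ = 1/(1024 D P)` (`u` a part size).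
[folklore] -/
theorem eps_mul_le {D P m a : ℕ} (hD : 1 ≤ D) (hP : 1 ≤ P) (hlt : a < 256 * D * m) {u : ℝ}
    (hu : u ≤ (a : ℝ) + 1) : 1 / (1024 * (D : ℝ) * P) * u * P ≤ m := by
  have hD0 : (0 : ℝ) < D := by exact_mod_cast hD
  have hP0 : (0 : ℝ) < P := by exact_mod_cast hP
  have h1 : (a : ℝ) + 1 ≤ 256 * D * m := by exact_mod_cast Nat.succ_le_of_lt hlt
  have h2 : 1 / (1024 * (D : ℝ) * P) * u * P = u / (1024 * D) := by field_simp
  have h3 : (0 : ℝ) ≤ D * m := by positivity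
  rw [h2, div_le_iff₀ (by positivity)]
  nlinarith

/-- **The bipartite graph of `X` has many ordered edges**: if `N² ≤ D #X`, `N > 0`, then
`(4 ε₀ + ε₁/2 + 4 η) (2N)² < N²/D ≤ #X ≤ #(ordered edges)` for the constants of
`constants_bounds` (the pairs `(inl x, inr y)`, `(x, y) ∈ X`, are ordered edges). [folklore] -/
theorem edges_lower_bound {D P N : ℕ} (hD : 1 ≤ D) (hP : 1 ≤ P) (hN : 0 < N)
    (X : Finset (Fin N × Fin N)) (hX : N ^ 2 ≤ D * X.card)
    (G : SimpleGraph (Fin N ⊕ Fin N)) [DecidableRel G.Adj]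
    (hG : ∀ a b, G.Adj a b ↔ ∃ x y, (x, y) ∈ X ∧
      (a = Sum.inl x ∧ b = Sum.inr y ∨ a = Sum.inr y ∧ b = Sum.inl x)) :
    (4 * (1 / (1024 * (D : ℝ) * P)) + 1 / (16 * D) / 2 + 4 * (1 / (64 * D))) *
      (Fintype.card (Fin N ⊕ Fin N) : ℝ) ^ 2 <
      #(univ.filter fun e : (Fin N ⊕ Fin N) × (Fin N ⊕ Fin N) => G.Adj e.1 e.2) := by
  have hD0 : (0 : ℝ) < D := by exact_mod_cast hD
  have hN0 : (0 : ℝ) < N := by exact_mod_cast hN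
  have hXE : X.card ≤
      #(univ.filter fun e : (Fin N ⊕ Fin N) × (Fin N ⊕ Fin N) => G.Adj e.1 e.2) := by
    rw [← card_map (Function.Embedding.inl.prodMap Function.Embedding.inr)]
    refine card_le_card fun e he => ?_
    rw [mem_map] at he
    obtain ⟨⟨x, y⟩, hxy, rfl⟩ := he
    simp only [mem_filter, mem_univ, true_and, Function.Embedding.coe_prodMap, Prod.map_apply]
    exact (hG _ _).2 ⟨x, y, hxy, Or.inl ⟨rfl, rfl⟩⟩
  have h2 : (N : ℝ) ^ 2 / D ≤ X.card := by
    rw [div_le_iff₀ hD0]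
    exact_mod_cast (mul_comm D X.card) ▸ hX
  have hcardW : (Fintype.card (Fin N ⊕ Fin N) : ℝ) = 2 * N := by
    rw [Fintype.card_sum, Fintype.card_fin]; push_cast; ring
  rw [hcardW]
  calc (4 * (1 / (1024 * (D : ℝ) * P)) + 1 / (16 * D) / 2 + 4 * (1 / (64 * D))) *
        (2 * (N : ℝ)) ^ 2
      ≤ 25 / (256 * D) * (2 * (N : ℝ)) ^ 2 := by gcongr; exact (constants_bounds hD hP).2.2.1
    _ = (100 / 256) * ((N : ℝ) ^ 2 / D) := by ring
    _ < 1 * ((N : ℝ) ^ 2 / D) := by gcongr; norm_num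
    _ ≤ _ := by rw [one_mul]; exact h2.trans (by exact_mod_cast hXE)

/-- **One dense `ε`-regular balanced pair from Szemerédi's lemma.** For `D, P, Cc ≥ 1` there
are `M, N₀ ≥ 1` such that every `X ⊆ Fin N × Fin N`, `N ≥ N₀`, with `N² ≤ D #X` contains rows
`V` and columns `W`, `#V = #W = m`, `N ≤ M m`, `Cc m ≤ N`, with `m² ≤ 256 D e_X(V, W)` and
`|e_X(S,T)/(#S #T) - e_X(V,W)/m²| ≤ 1/P` for all `S ⊆ V`, `T ⊆ W` with `m ≤ P #S`, `m ≤ P #T`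
(`M = 256 D L`, `N₀ = 128 D L`, `L = bound (1/(1024 D P)) (64 D + 2 Cc)`; the lemmas above applied
to the bipartite graph of `X` on `Fin N ⊕ Fin N`). [folklore] -/
theorem stub_denseRegularPair :
    ∀ D P Cc : ℕ, 1 ≤ D → 1 ≤ P → 1 ≤ Cc → ∃ M N₀ : ℕ, 1 ≤ M ∧ ∀ N ≥ N₀, ∀ X : Finset (Fin N × Fin N),
      N ^ 2 ≤ D * X.card →
      ∃ (m : ℕ) (V W : Finset (Fin N)), V.card = m ∧ W.card = m ∧ N ≤ M * m ∧ Cc * m ≤ N ∧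
        m * m ≤ 256 * D * (X.filter fun e => e.1 ∈ V ∧ e.2 ∈ W).card ∧
        ∀ S ⊆ V, ∀ T ⊆ W, m ≤ P * S.card → m ≤ P * T.card →
          |(((X.filter fun e => e.1 ∈ S ∧ e.2 ∈ T).card : ℕ) : ℝ) / ((S.card : ℝ) * (T.card : ℝ)) -
            (((X.filter fun e => e.1 ∈ V ∧ e.2 ∈ W).card : ℕ) : ℝ) / ((m : ℝ) * (m : ℝ))| ≤ 1 / (P : ℝ) := by
  intro D P Cc hD hP hCc
  obtain ⟨hεP, hDη, -, hlε'⟩ := constants_bounds hD hP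
  set ε₀ : ℝ := 1 / (1024 * (D : ℝ) * P)
  set l : ℕ := 64 * D + 2 * Cc with hl
  have hε₀pos : 0 < ε₀ := by positivity
  have hLpos : 0 < bound ε₀ l := bound_pos ε₀ l
  refine ⟨256 * D * bound ε₀ l, 128 * D * bound ε₀ l,
    le_trans hLpos (Nat.le_mul_of_pos_left _ (by omega)), fun N hN X hX => ?_⟩
  set L : ℕ := bound ε₀ l
  have hlL : l ≤ L := le_bound ε₀ l
  have hNL : L ≤ N := le_trans (Nat.le_mul_of_pos_left L (by omega)) hN
  have hNpos : 0 < N := lt_of_lt_of_le hLpos hNL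
  haveI : Nonempty (Fin N ⊕ Fin N) := ⟨Sum.inl ⟨0, hNpos⟩⟩
  -- the bipartite graph of `X` on `Fin N ⊕ Fin N`, used only through `hΓ`
  obtain ⟨Γ, hΓ⟩ : ∃ Γ : SimpleGraph (Fin N ⊕ Fin N), ∀ a b, Γ.Adj a b ↔ ∃ x y, (x, y) ∈ X ∧
      (a = Sum.inl x ∧ b = Sum.inr y ∨ a = Sum.inr y ∧ b = Sum.inl x) :=
    ⟨{ Adj := fun a b => ∃ x y, (x, y) ∈ X ∧
          (a = Sum.inl x ∧ b = Sum.inr y ∨ a = Sum.inr y ∧ b = Sum.inl x),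
       symm := ⟨fun a b ⟨x, y, h, hab⟩ => ⟨x, y, h, hab.symm.imp And.symm And.symm⟩⟩,
       loopless := ⟨fun a ⟨x, y, _, hab⟩ => by
         rcases hab with ⟨rfl, h⟩ | ⟨rfl, h⟩ <;> cases h⟩ }, fun _ _ => Iff.rfl⟩
  haveI : DecidableRel Γ.Adj := Classical.decRel _
  have hcardW : Fintype.card (Fin N ⊕ Fin N) = 2 * N := by
    rw [Fintype.card_sum, Fintype.card_fin]; ring
  have hlW : l ≤ Fintype.card (Fin N ⊕ Fin N) := by rw [hcardW]; omega
  have hlε : (4 : ℝ) / (1 / (16 * D)) ≤ l := by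
    rw [hlε', hl]
    push_cast
    linarith [(Nat.cast_nonneg Cc : (0 : ℝ) ≤ Cc)]
  -- the regularity step, the orientation, the sizes, the restriction
  obtain ⟨k, U, U', hlk, hkL, hUa, hUa', hU'a, hU'a', huni, hdens⟩ :=
    exists_uniform_dense_pair Γ hε₀pos (by positivity) (by positivity) hlW hlε
      (edges_lower_bound hD hP hNpos X hX Γ hΓ)
  rw [hcardW] at hUa hUa' hU'a hU'a'
  obtain ⟨h256, h128, hlt, hNM, hCm⟩ := nat_sizes hD hCc hl hlk hkL hN
  set a : ℕ := 2 * N / k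
  set m : ℕ := a / (256 * D) + 1
  have hapos : 0 < a := by omega
  obtain ⟨U₁, U₂, R, C, hor, hRU, hCU, hR, hC⟩ := exists_orientation X Γ hΓ
    (lt_of_lt_of_le hapos hUa) (lt_of_lt_of_le hapos hU'a) hdens
  obtain ⟨hu12, hd12, hU₁a, hU₁a', hU₂a, hU₂a'⟩ : Γ.IsUniform ε₀ U₁ U₂ ∧
      (1 / (64 * (D : ℝ))) ≤ Γ.edgeDensity U₁ U₂ ∧ a ≤ #U₁ ∧ #U₁ ≤ a + 1 ∧ a ≤ #U₂ ∧
      #U₂ ≤ a + 1 := by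
    rcases hor with ⟨rfl, rfl⟩ | ⟨rfl, rfl⟩
    · exact ⟨huni, hdens, hUa, hUa', hU'a, hU'a'⟩
    · exact ⟨huni.symm, by rwa [SimpleGraph.edgeDensity_comm], hU'a, hU'a', hUa, hUa'⟩
  have hmR : m ≤ #R := by exact_mod_cast cast_le_of_rows hD h128 (by exact_mod_cast hU₁a) hR
  have hmC : m ≤ #C := by exact_mod_cast cast_le_of_rows hD h128 (by exact_mod_cast hU₂a) hC
  obtain ⟨V, W, hVm, hWm, hdense, hreg⟩ := restrict_pair X Γ hΓ hP hD hu12 hd12 hRU hCU hmR hmC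
    (eps_mul_le hD hP hlt (by exact_mod_cast hU₁a')) (eps_mul_le hD hP hlt (by exact_mod_cast hU₂a'))
    hεP hDη
  exact ⟨m, V, W, hVm, hWm, hNM, hCm, hdense, hreg⟩

end Summit.ValiantsHypothesis.ValiantsHypothesis.Theorems.DivisionGap.PerMultiplesHard.DenseRegularPair
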